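import Mathlib.Analysis.SpecialFunctions.Elliptic.Weierstrass
import Mathlib.NumberTheory.ModularForms.EisensteinSeries.Defs
import Mathlib.NumberTheory.ModularForms.SlashActions
import Mathlib.NumberTheory.ModularForms.CongruenceSubgroups
import Mathlib.NumberTheory.DirichletCharacter.Basic
import HarnessLib

/-!
# `℘`-division values: the weight-`2` vector-valued modular forms `℘((cτ + d)/N; τ)`

Topic `Literature/NumberTheory/EllipticCurves`; namespace
`Literature.NumberTheory.EllipticCurves.ModularForms`.

For `τ ∈ ℍ`, `Λ_τ = ℤτ + ℤ`, `N ≥ 1` and `v = (c_v, d_v) ∈ ℤ²`, the **`℘`-division value**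
`f_v(τ) = ℘_{Λ_τ}((c_v τ + d_v)/N)` (Weierstrass `℘` of the lattice `Λ_τ` at the `N`-division
point `(c_v τ + d_v)/N`), written as the absolutely convergent lattice sum
`∑_{x ∈ ℤ²} ( N²/((c_v - N x₀)τ + (d_v - N x₁))² - 1/(x₀ τ + x₁)² )` (`weierstrassPDiv`; with the
convention `1/0 = 0` this is Mathlib's `PeriodPair.weierstrassP` of the period pair `(τ, 1)`,
`weierstrassPDiv_eq_weierstrassP`).  These satisfy the exact transformation law of a
vector-valued modular form of weight `2`:

* `weierstrassPDiv_slash` — `f_v ∣₂ γ = f_{vγ}` for all `γ ∈ SL₂(ℤ)` (homogeneity of `℘` and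
  `Λ_{γτ} = (cτ + d)⁻¹ Λ_τ`, computed termwise via `EisensteinSeries.eisSummand_SL2_apply`);
* `weierstrassPDiv_add_nsmul` — `f_{v + Nw} = f_v` (periodicity of `℘`), so `f_v` depends on
  `v mod N`;
* `weierstrassPDivChar_slash_of_mem_gamma0` — for a Dirichlet character `χ` mod `N`, the
  combination `S_χ = ∑_{e mod N} χ̄(e) f_{(0,e)}` satisfies `S_χ ∣₂ γ = χ(d) S_χ` for
  `γ = (a b; c d) ∈ Γ₀(N)`: it has nebentypus `χ`.  (`S_χ` is `-8π² W(χ̄) E_2^{𝟙,χ}` up to its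
  constant term, Diamond–Shurman §4.6, §4.8.)

This is the classical construction of weight-`2` Eisenstein series of level `N` from
`℘`-division values (Diamond–Shurman, *A First Course in Modular Forms*, §1.5 (`℘` and modular
forms of weight 2 for `Γ(N)`), §4.6 eq. (4.23)–(4.25), §4.8); only exact lattice manipulations
are used — no conditionally convergent series.

## References

* F. Diamond, J. Shurman, *A First Course in Modular Forms*, GTM 228 (2005), §1.5, §4.6, §4.8.
  [DiamondShurman2005]
-/

noncomputable section

open UpperHalfPlane EisensteinSeries ModularForm CongruenceSubgroup Matrix PeriodPair

open scoped MatrixGroups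

namespace Literature.NumberTheory.EllipticCurves.ModularForms

/-! ### The period pair `(τ, 1)` -/

/-- The period pair `(τ, 1)` of a point `τ` of the upper half plane (lattice `Λ_τ = ℤτ + ℤ`). [folklore] -/
def periodPairOfUpperHalfPlane (τ : ℍ) : PeriodPair where
  ω₁ := τ
  ω₂ := 1
  indep := by
    refine LinearIndependent.pair_iff.2 fun s t h ↦ ?_
    have him := congrArg Complex.im h
    simp only [Complex.add_im, Complex.real_smul, Complex.mul_im, Complex.ofReal_re,
      Complex.ofReal_im, zero_mul, add_zero, Complex.one_im, mul_zero, Complex.zero_im,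
      UpperHalfPlane.coe_im] at him
    have hs : s = 0 := by
      rcases mul_eq_zero.1 him with h1 | h1
      · exact h1
      · exact absurd h1 τ.im_pos.ne'
    subst hs
    have hre := congrArg Complex.re h
    simp at hre
    exact ⟨rfl, hre⟩

/-- The first period of `(τ, 1)` is `τ`. [folklore] -/
@[simp] theorem periodPairOfUpperHalfPlane_ω₁ (τ : ℍ) : (periodPairOfUpperHalfPlane τ).ω₁ = τ :=
  rfl

/-- The second period of `(τ, 1)` is `1`. [folklore] -/
@[simp] theorem periodPairOfUpperHalfPlane_ω₂ (τ : ℍ) : (periodPairOfUpperHalfPlane τ).ω₂ = 1 :=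
  rfl

/-- `mτ + n ∈ Λ_τ`. [folklore] -/
theorem intCast_mul_add_intCast_mem_lattice (τ : ℍ) (m n : ℤ) :
    (m : ℂ) * τ + n ∈ (periodPairOfUpperHalfPlane τ).lattice :=
  PeriodPair.mem_lattice.2 ⟨m, n, by simp⟩

/-! ### `℘`-division values as lattice sums -/

/-- The **`℘`-division value** `f_v(τ) = ℘_{Λ_τ}((c_v τ + d_v)/N)`, `v = (c_v, d_v)`, as the
absolutely convergent lattice sum `∑_{x ∈ ℤ²} (N²/((c_v - Nx₀)τ + (d_v - Nx₁))² - 1/(x₀τ + x₁)²)`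
(Mathlib conventions `1/0 = 0`; see `weierstrassPDiv_eq_weierstrassP`).
[cite: DiamondShurman2005, §1.5 and §4.6] -/
def weierstrassPDiv (N : ℕ) (v : Fin 2 → ℤ) (τ : ℍ) : ℂ :=
  ∑' x : Fin 2 → ℤ, ((N : ℂ) ^ 2 * eisSummand 2 (v - (N : ℤ) • x) τ - eisSummand 2 x τ)

variable {N : ℕ}

/-- The summand of `weierstrassPDiv` is the summand `1/(u - l)² - 1/l²` of `℘_{Λ_τ}(u)`,
`u = (c_v τ + d_v)/N`, at the lattice point `l = x₀ τ + x₁`. [folklore] -/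
theorem weierstrassPDiv_summand_eq (hN : N ≠ 0) (v x : Fin 2 → ℤ) (τ : ℍ) :
    (N : ℂ) ^ 2 * eisSummand 2 (v - (N : ℤ) • x) τ - eisSummand 2 x τ =
      1 / ((((v 0 : ℂ) * τ + v 1) / N) - ((x 0 : ℂ) * τ + x 1)) ^ 2 -
        1 / ((x 0 : ℂ) * τ + x 1) ^ 2 := by
  have hN' : (N : ℂ) ≠ 0 := by exact_mod_cast hN
  have h0 : ((v - (N : ℤ) • x) 0 : ℤ) = v 0 - N * x 0 := by simp
  have h1 : ((v - (N : ℤ) • x) 1 : ℤ) = v 1 - N * x 1 := by simp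
  simp only [eisSummand, h0, h1, Int.cast_sub, Int.cast_mul, Int.cast_natCast, zpow_neg,
    zpow_ofNat, one_div]
  congr 1
  have h : (((v 0 : ℂ) * τ + v 1) / N - ((x 0 : ℂ) * τ + x 1)) =
      (((v 0 : ℂ) - N * x 0) * τ + ((v 1 : ℂ) - N * x 1)) / N := by
    field_simp
    ring
  rw [h, div_pow, inv_div, div_eq_mul_inv]

/-- **`f_v(τ) = ℘_{Λ_τ}((c_v τ + d_v)/N)`**: the lattice sum is Mathlib's Weierstrass `℘` of the
period pair `(τ, 1)`. [cite: DiamondShurman2005, §1.5] -/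
theorem hasSum_weierstrassPDiv (hN : N ≠ 0) (v : Fin 2 → ℤ) (τ : ℍ) :
    HasSum (fun x : Fin 2 → ℤ ↦ (N : ℂ) ^ 2 * eisSummand 2 (v - (N : ℤ) • x) τ - eisSummand 2 x τ)
      (℘[periodPairOfUpperHalfPlane τ] (((v 0 : ℂ) * τ + v 1) / N)) := by
  set L := periodPairOfUpperHalfPlane τ with hL
  set e : (Fin 2 → ℤ) ≃ L.lattice := L.latticeBasis.equivFun.symm.toEquiv with he
  have hcoe : ∀ x : Fin 2 → ℤ, ((e x : L.lattice) : ℂ) = (x 0 : ℂ) * τ + x 1 := by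
    intro x
    rw [he, LinearEquiv.coe_toEquiv, Module.Basis.equivFun_symm_apply, Fin.sum_univ_two,
      Submodule.coe_add, Submodule.coe_smul_of_tower, Submodule.coe_smul_of_tower,
      PeriodPair.latticeBasis_zero, PeriodPair.latticeBasis_one, hL, periodPairOfUpperHalfPlane_ω₁,
      periodPairOfUpperHalfPlane_ω₂, zsmul_eq_mul, zsmul_eq_mul, mul_one]
  have h := (L.hasSum_weierstrassP (((v 0 : ℂ) * τ + v 1) / N))
  rw [← e.hasSum_iff] at h
  convert h using 1
  funext x
  rw [Function.comp_apply, hcoe x, weierstrassPDiv_summand_eq hN]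

/-- `f_v(τ) = ℘_{Λ_τ}((c_v τ + d_v)/N)`. [cite: DiamondShurman2005, §1.5] -/
theorem weierstrassPDiv_eq_weierstrassP (hN : N ≠ 0) (v : Fin 2 → ℤ) (τ : ℍ) :
    weierstrassPDiv N v τ = ℘[periodPairOfUpperHalfPlane τ] (((v 0 : ℂ) * τ + v 1) / N) :=
  (hasSum_weierstrassPDiv hN v τ).tsum_eq

/-- The lattice sum defining `f_v` is summable. [folklore] -/
theorem summable_weierstrassPDiv (hN : N ≠ 0) (v : Fin 2 → ℤ) (τ : ℍ) :
    Summable (fun x : Fin 2 → ℤ ↦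
      (N : ℂ) ^ 2 * eisSummand 2 (v - (N : ℤ) • x) τ - eisSummand 2 x τ) :=
  (hasSum_weierstrassPDiv hN v τ).summable

/-! ### Periodicity in `v` -/

/-- **`f_{v + Nw} = f_v`**: `℘_{Λ_τ}` is `Λ_τ`-periodic and `(c_{v+Nw}τ + d_{v+Nw})/N` differs from
`(c_v τ + d_v)/N` by `w₀ τ + w₁ ∈ Λ_τ`. [cite: DiamondShurman2005, §1.5] -/
theorem weierstrassPDiv_add_nsmul (hN : N ≠ 0) (v w : Fin 2 → ℤ) (τ : ℍ) :
    weierstrassPDiv N (v + (N : ℤ) • w) τ = weierstrassPDiv N v τ := by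
  have hN' : (N : ℂ) ≠ 0 := by exact_mod_cast hN
  rw [weierstrassPDiv_eq_weierstrassP hN, weierstrassPDiv_eq_weierstrassP hN]
  have h0 : ((v + (N : ℤ) • w) 0 : ℤ) = v 0 + N * w 0 := by simp
  have h1 : ((v + (N : ℤ) • w) 1 : ℤ) = v 1 + N * w 1 := by simp
  have h : ((((v + (N : ℤ) • w) 0 : ℤ) : ℂ) * τ + ((v + (N : ℤ) • w) 1 : ℤ)) / N =
      ((v 0 : ℂ) * τ + v 1) / N + ((w 0 : ℂ) * τ + w 1) := by
    rw [h0, h1]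
    push_cast
    field_simp
    ring
  rw [h]
  exact (periodPairOfUpperHalfPlane τ).weierstrassP_add_coe _
    ⟨_, intCast_mul_add_intCast_mem_lattice τ (w 0) (w 1)⟩

/-- `f_v` only depends on `v mod N`. [cite: DiamondShurman2005, §1.5] -/
theorem weierstrassPDiv_congr_mod (hN : N ≠ 0) {v v' : Fin 2 → ℤ}
    (h : ∀ i, (v i : ZMod N) = (v' i : ZMod N)) (τ : ℍ) :
    weierstrassPDiv N v τ = weierstrassPDiv N v' τ := by
  have hw : ∀ i, ∃ w : ℤ, v' i = v i + N * w := fun i ↦ by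
    obtain ⟨w, hw⟩ := (ZMod.intCast_eq_intCast_iff_dvd_sub (v i) (v' i) N).1 (h i)
    exact ⟨w, by linarith⟩
  choose w hw using hw
  have : v' = v + (N : ℤ) • (fun i ↦ w i) := by
    funext i
    rw [Pi.add_apply, Pi.smul_apply, smul_eq_mul]
    exact hw i
  rw [this, weierstrassPDiv_add_nsmul hN]

/-- `f_{-v} = f_v` (`℘` is even). [folklore] -/
theorem weierstrassPDiv_neg (hN : N ≠ 0) (v : Fin 2 → ℤ) (τ : ℍ) :
    weierstrassPDiv N (-v) τ = weierstrassPDiv N v τ := by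
  rw [weierstrassPDiv_eq_weierstrassP hN, weierstrassPDiv_eq_weierstrassP hN,
    ← PeriodPair.weierstrassP_neg]
  congr 1
  simp only [Pi.neg_apply, Int.cast_neg]
  ring

/-! ### The weight-`2` transformation law -/

/-- Right multiplication by `γ ∈ SL₂(ℤ)` is a permutation of `ℤ²` (private copy of
`vecMulEquiv` of `EisensteinWeightOneCusps`, not imported here). [folklore] -/
private def vecMulPerm (γ : SL(2, ℤ)) : (Fin 2 → ℤ) ≃ (Fin 2 → ℤ) where
  toFun x := x ᵥ* (γ : Matrix (Fin 2) (Fin 2) ℤ)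
  invFun x := x ᵥ* ((γ⁻¹ : SL(2, ℤ)) : Matrix (Fin 2) (Fin 2) ℤ)
  left_inv x := by
    simp only [Matrix.vecMul_vecMul, ← Matrix.SpecialLinearGroup.coe_mul, mul_inv_cancel,
      Matrix.SpecialLinearGroup.coe_one, Matrix.vecMul_one]
  right_inv x := by
    simp only [Matrix.vecMul_vecMul, ← Matrix.SpecialLinearGroup.coe_mul, inv_mul_cancel,
      Matrix.SpecialLinearGroup.coe_one, Matrix.vecMul_one]

/-- `vecMulPerm γ x = x γ`. [folklore] -/
@[simp] private theorem vecMulPerm_apply (γ : SL(2, ℤ)) (x : Fin 2 → ℤ) :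
    vecMulPerm γ x = x ᵥ* (γ : Matrix (Fin 2) (Fin 2) ℤ) := rfl

/-- **`f_v(γτ) = (cτ + d)² f_{vγ}(τ)`** for `γ ∈ SL₂(ℤ)`: both lattice-sum terms transform by
`EisensteinSeries.eisSummand_SL2_apply`, and `x ↦ xγ` permutes `ℤ²`.
[cite: DiamondShurman2005, §1.5 (`℘`-division values are weight-2 modular for `Γ(N)`)] -/
theorem weierstrassPDiv_smul (N : ℕ) (v : Fin 2 → ℤ) (γ : SL(2, ℤ)) (τ : ℍ) :
    weierstrassPDiv N v (γ • τ) =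
      denom γ τ ^ (2 : ℤ) * weierstrassPDiv N (v ᵥ* (γ : Matrix (Fin 2) (Fin 2) ℤ)) τ := by
  unfold weierstrassPDiv
  have hterm : ∀ x : Fin 2 → ℤ,
      (N : ℂ) ^ 2 * eisSummand 2 (v - (N : ℤ) • x) (γ • τ) - eisSummand 2 x (γ • τ) =
        denom γ τ ^ (2 : ℤ) * ((N : ℂ) ^ 2 *
          eisSummand 2 (v ᵥ* (γ : Matrix (Fin 2) (Fin 2) ℤ) - (N : ℤ) • vecMulPerm γ x) τ -
            eisSummand 2 (vecMulPerm γ x) τ) := by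
    intro x
    rw [eisSummand_SL2_apply, eisSummand_SL2_apply, vecMulPerm_apply, Matrix.sub_vecMul,
      Matrix.smul_vecMul]
    ring
  simp_rw [hterm]
  rw [tsum_mul_left]
  congr 1
  exact (vecMulPerm γ).tsum_eq (fun y ↦ (N : ℂ) ^ 2 *
    eisSummand 2 (v ᵥ* (γ : Matrix (Fin 2) (Fin 2) ℤ) - (N : ℤ) • y) τ - eisSummand 2 y τ)

/-- **`f_v ∣₂ γ = f_{vγ}`** for every `γ ∈ SL₂(ℤ)`: the `℘`-division values form a vector-valued
modular form of weight `2` permuted by `SL₂(ℤ)` through its right action on `ℤ² mod N`.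
[cite: DiamondShurman2005, §1.5] -/
theorem weierstrassPDiv_slash (N : ℕ) (v : Fin 2 → ℤ) (γ : SL(2, ℤ)) :
    (weierstrassPDiv N v) ∣[(2 : ℤ)] γ =
      weierstrassPDiv N (v ᵥ* (γ : Matrix (Fin 2) (Fin 2) ℤ)) := by
  funext τ
  rw [ModularForm.SL_slash_apply, weierstrassPDiv_smul, mul_comm, ← mul_assoc, ← zpow_add₀
    (denom_ne_zero γ τ), show -(2 : ℤ) + 2 = 0 by norm_num, zpow_zero, one_mul]

/-! ### The character combination `S_χ = ∑_e χ̄(e) f_{(0,e)}` -/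

/-- **`S_χ(τ) = ∑_{e mod N} χ̄(e) ℘_{Λ_τ}(e/N)`**, the `χ`-combination of the `℘`-values at the
real `N`-division points (`-8π² W(χ̄) E_2^{𝟙,χ}` up to the constant term).
[cite: DiamondShurman2005, §4.6 and §4.8] -/
def weierstrassPDivChar [NeZero N] (χ : DirichletCharacter ℂ N) (τ : ℍ) : ℂ :=
  ∑ e : ZMod N, χ⁻¹ e * weierstrassPDiv N ![0, (e.val : ℤ)] τ

/-- Entries of `w γ` for `w ∈ ℤ²`. [folklore] -/
private theorem vecMul_fin_two (w : Fin 2 → ℤ) (A : Matrix (Fin 2) (Fin 2) ℤ) (j : Fin 2) :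
    (w ᵥ* A) j = w 0 * A 0 j + w 1 * A 1 j := by
  simp [Matrix.vecMul, dotProduct, Fin.sum_univ_two]

/-- `(0, e) γ ≡ (0, e d) (mod N)` for `γ = (a b; c d) ∈ Γ₀(N)`, so `f_{(0,e)γ} = f_{(0, ed mod N)}`.
[folklore] -/
theorem weierstrassPDiv_vecMul_of_mem_gamma0 [NeZero N] {γ : SL(2, ℤ)} (hγ : γ ∈ Gamma0 N)
    (e : ZMod N) (τ : ℍ) :
    weierstrassPDiv N (![0, (e.val : ℤ)] ᵥ* (γ : Matrix (Fin 2) (Fin 2) ℤ)) τ =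
      weierstrassPDiv N ![0, ((e * ((γ 1 1 : ℤ) : ZMod N)).val : ℤ)] τ := by
  have hc : (((γ 1 0 : ℤ) : ZMod N)) = 0 := by
    have h := hγ
    rw [Gamma0_mem] at h
    exact_mod_cast h
  refine weierstrassPDiv_congr_mod (NeZero.ne N) (fun i ↦ ?_) τ
  fin_cases i
  · show (((![0, (e.val : ℤ)] ᵥ* (γ : Matrix (Fin 2) (Fin 2) ℤ)) 0 : ℤ) : ZMod N) =
      ((![0, ((e * ((γ 1 1 : ℤ) : ZMod N)).val : ℤ)] 0 : ℤ) : ZMod N)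
    rw [vecMul_fin_two]
    simp [hc]
  · show (((![0, (e.val : ℤ)] ᵥ* (γ : Matrix (Fin 2) (Fin 2) ℤ)) 1 : ℤ) : ZMod N) =
      ((![0, ((e * ((γ 1 1 : ℤ) : ZMod N)).val : ℤ)] 1 : ℤ) : ZMod N)
    rw [vecMul_fin_two]
    simp

/-- **`S_χ ∣₂ γ = χ(d) S_χ` for `γ = (a b; c d) ∈ Γ₀(N)`**: the combination
`S_χ = ∑_e χ̄(e) f_{(0,e)}` has nebentypus `χ` (`f_{(0,e)} ∣₂ γ = f_{(0,e)γ} = f_{(0,ed)}` and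
`χ̄(e) = χ(d) χ̄(ed)`). [cite: DiamondShurman2005, §4.6 and §4.8 (weight-2 Eisenstein series with character from `℘`-division values)] -/
theorem weierstrassPDivChar_slash_of_mem_gamma0 [NeZero N] (χ : DirichletCharacter ℂ N)
    {γ : SL(2, ℤ)} (hγ : γ ∈ Gamma0 N) :
    (weierstrassPDivChar χ) ∣[(2 : ℤ)] γ =
      χ ((γ 1 1 : ℤ) : ZMod N) • weierstrassPDivChar χ := by
  classical
  -- `d` is a unit mod `N`
  have hdet : (γ 0 0 : ℤ) * γ 1 1 - γ 0 1 * γ 1 0 = 1 := by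
    have := Matrix.SpecialLinearGroup.det_coe γ
    rw [Matrix.det_fin_two] at this
    exact this
  have hc : (((γ 1 0 : ℤ) : ZMod N)) = 0 := by
    have h := hγ
    rw [Gamma0_mem] at h
    exact_mod_cast h
  have hd1 : ((γ 0 0 : ℤ) : ZMod N) * ((γ 1 1 : ℤ) : ZMod N) = 1 := by
    have := congrArg ((↑) : ℤ → ZMod N) hdet
    push_cast at this
    rw [hc, mul_zero, sub_zero] at this
    exact this
  have hu : IsUnit (((γ 1 1 : ℤ) : ZMod N)) := IsUnit.of_mul_eq_one_right _ hd1
  set u : (ZMod N)ˣ := hu.unit with hu_def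
  have huval : (u : ZMod N) = ((γ 1 1 : ℤ) : ZMod N) := hu.unit_spec
  funext τ
  simp only [ModularForm.SL_slash_apply, weierstrassPDivChar, Pi.smul_apply, smul_eq_mul,
    Finset.sum_mul, Finset.mul_sum]
  -- each term: `χ̄(e) f_{(0,e)}(γτ) (cτ+d)^{-2} = χ̄(e) f_{(0, e d)}(τ)`
  have hterm : ∀ e : ZMod N, χ⁻¹ e * weierstrassPDiv N ![0, (e.val : ℤ)] (γ • τ) *
      denom γ τ ^ (-(2 : ℤ)) = χ⁻¹ e * weierstrassPDiv N ![0, ((e * u).val : ℤ)] τ := by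
    intro e
    have h := congr_fun (weierstrassPDiv_slash N ![0, (e.val : ℤ)] γ) τ
    rw [ModularForm.SL_slash_apply, weierstrassPDiv_vecMul_of_mem_gamma0 hγ, ← huval] at h
    rw [mul_assoc, h]
  simp_rw [hterm]
  have hχd : χ ((γ 1 1 : ℤ) : ZMod N) ≠ 0 := by
    intro h0
    have := congrArg χ hd1
    rw [map_mul, map_one, h0, mul_zero] at this
    exact zero_ne_one this
  -- reindex `e ↦ e u` on the right
  symm
  calc ∑ e : ZMod N, χ ((γ 1 1 : ℤ) : ZMod N) * (χ⁻¹ e * weierstrassPDiv N ![0, (e.val : ℤ)] τ)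
      = ∑ e : ZMod N, χ ((γ 1 1 : ℤ) : ZMod N) *
          (χ⁻¹ (e * u) * weierstrassPDiv N ![0, ((e * u).val : ℤ)] τ) :=
        (Fintype.sum_equiv (Units.mulRight u)
          (fun e ↦ χ ((γ 1 1 : ℤ) : ZMod N) *
            (χ⁻¹ (e * u) * weierstrassPDiv N ![0, ((e * u).val : ℤ)] τ))
          (fun e ↦ χ ((γ 1 1 : ℤ) : ZMod N) * (χ⁻¹ e * weierstrassPDiv N ![0, (e.val : ℤ)] τ))
          (fun e ↦ rfl)).symm
    _ = ∑ e : ZMod N, χ⁻¹ e * weierstrassPDiv N ![0, ((e * u).val : ℤ)] τ := by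
        refine Finset.sum_congr rfl fun e _ ↦ ?_
        rw [map_mul, MulChar.inv_apply_eq_inv' χ (u : ZMod N), huval]
        field_simp

end Literature.NumberTheory.EllipticCurves.ModularForms
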